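import Literature.NumberTheory.EllipticCurves.Castella2024.MultiplicativeHeegnerPointMainConjecture
import Literature.NumberTheory.EllipticCurves.KellerYin2024.MultiplicativeHeegnerPointMainConjecture
import Literature.NumberTheory.EllipticCurves.BSDSelmerPConverseHeegnerSpecializationProofs
import Literature.NumberTheory.EllipticCurves.Castella2024.LambdaAdicHeegnerClassExistence
import HarnessLib

/-!
# The exceptional zero `pr_0(𝐳_∞) = 0` at a SPLIT multiplicative prime, as a consequence of the typed
# Heegner point main conjectures (Castella 2024 Thm. 1.3 / Keller–Yin 2024a Thm. 5.2.1) — PROVED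

Topic `NumberTheory/EllipticCurves`, sub-directory `Castella2024`; theorems only (no definition, no
named fact; cross-ladder LITERATURE-TYPING layer D-0088(4), cell `bsd-littype`, seat `bsd-littype-05`).

Castella, arXiv:2409.01360v1, **Theorem 2.1** (`thm:exc-zero`, TeX of record
`run/shared/lean/pub/bsd-eis/lit/src/cas24-src/multiplicative-conv.tex` l.417–425), first assertion:
"Suppose `E` has split multiplicative reduction at `p`, and that `E(K)[p] = 0`. Then `pr_0(𝐳_∞) = 0`"
(printed proof, l.428–434: `pr_0(𝐳_∞) = cor_{H_1/K}(z_0) = u⁻¹(1 - α⁻¹) ∑_τ y_1^τ` and `α = 1`; =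
Bertolini–Darmon 1996 §2.5 eq. (8)); Keller–Yin arXiv:2402.12781v2 L1781: "this `(γ-1)` factor
reflects a trivial zero of the `p`-adic `L`-function". Its second assertion (`pr_0(𝐳_∞') =
𝓛_𝔭(f,K) · κ_f`, an `𝓛`-invariant, via [molina-TAMS Thm. 7.5]) is NOT treated here.

What is PROVED: in the tree's vocabulary the typed main conjectures at a split multiplicative `p`
(`Castella2024.thm13_charIdeal_torsion_eq_sq_OPEN`, `KellerYin2024.thm521_multHg_charIdeal_torsion_eq_sq_OPEN`)
give the derived class, `𝐳_∞ = (γ - 1) 𝐳_∞'`, i.e. `z = T • z'` in the `Λ`-adic Selmer datum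
(`LambdaAdicSelmerData.proj_X`: `T` acts as `conj_γ - 1`), and `pr_0` kills `T • 𝔖_p` because
conjugation is trivial on `H¹(K, ·)` (tree theorem `LambdaAdicSelmerData.proj_zero_X_smul`, from
`conjH1_of_mem_holds`; Howard 2004 §1, Perrin-Riou 1987 §0). Hence, CONDITIONAL on either OPEN
hypothesis (unrefereed claims; typed ≠ proved ≠ endorsed), the layer-`K` component of the `Λ`-adic
Heegner class of sign `α = a_p = 1` vanishes: `D.proj 0 z = 0` — Castella's first assertion, for the
class `z` of `Castella2024.IsLambdaAdicHeegnerClass D F 1 z`, without the hypothesis `E(K)[p] = 0`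
(which print needs only to make `𝐳_∞'` unique). Nothing about any curve is asserted unconditionally.

Existence forms (appended, seat g3): for a COHERENT Heegner family (`HeegnerFamily.IsNormCompatible F γ
α`, Bertolini–Darmon 1996 §2.4/§2.5 (7)) the class the binders quantify over EXISTS
(`Castella2024.exists_isLambdaAdicHeegnerClass`, Prop. 2.7, file `LambdaAdicHeegnerClassExistence`), so
each `∀ z, IsLambdaAdicHeegnerClass … z → …` clause of Thm. 1.3 / Thm. 5.2.1 becomes a genuine `∃ z`
statement: `exists_heegnerClass_charIdeal_eq_of_thm13_OPEN_of_not_split`,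
`exists_heegnerClass_derived_of_thm13_OPEN_of_split`, and the `kellerYin_thm521` twins.

PINNED readers (appended 2026-08-27, ARM P DD-70 = r17 ADDENDUM-4 0434952c634f1c51 §D DD-candidate, lead
RULING (323); typer bsd-cited-ty4): after TY-QUEUE 25 (lead RULING (316), p501225) the statement file carries
beside the unpinned `thm13_charIdeal_torsion_eq_sq_OPEN` — whose `∀ F` layout is refuted integrally off the pin
(`Castella2024.false_of_thm13_OPEN_of_witness`) — the CONSISTENT pinned twin
`thm13_charIdeal_torsion_eq_sq_minimal_OPEN` (degree-minimal parametrisation datum with `p`-adic-unit Manin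
constant; flag `HPMC-Manin-normalisation`). The three Castella readers above are re-stated on the pinned twin,
with the two pin hypotheses `hmin` / `hc` threaded to `F` and the same one-line proofs:
`proj_zero_eq_zero_of_thm13_minimal_OPEN_of_split`,
`exists_heegnerClass_charIdeal_eq_of_thm13_minimal_OPEN_of_not_split`,
`exists_heegnerClass_derived_of_thm13_minimal_OPEN_of_split` — so that row 17's consistent statement has
consumers. The unpinned readers are kept (they remain the record of why the twin exists).

## References
* [Castella2024] arXiv:2409.01360v1, Thm. 2.1 (l.417–425, proof l.428–434), Thm. 1.3 (l.305–325).
* [KellerYin2024] arXiv:2402.12781v2, §5.2 (L1781), Thm. 5.2.1 (L1783–L1792).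
* [BertoliniDarmon1996] Invent. Math. 126, §2.5 eq. (8) (`u Norm_{K_1/K_0}(y_1) = (a_p - σ) y_0`), Prop. 2.7.
* [Howard2004HeegnerKolyvagin] §1 eq. (2); [PerrinRiou1987BSMF] §0 p. 402 (the `Λ`-structure,
  `pr_0 ∘ (γ - 1) = 0`), tree `LambdaAdicSelmerData.proj_zero_X_smul`.
-/

set_option autoImplicit false

noncomputable section

open scoped Classical

open WeierstrassCurve Literature.NumberTheory.EllipticCurves

universe u

namespace Literature.NumberTheory.EllipticCurves.Castella2024

variable {N : ℕ} [NeZero N] {W : WeierstrassCurve ℚ} {K : Type u} [Field K] [NumberField K]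
  {p : ℕ} [Fact p.Prime] {κ : ZpExtension K p} {γ : Field.absoluteGaloisGroup K}
  {jbar : AlgebraicClosure K →+* ℂ}

/-- **A derived class forces the exceptional zero**: if `z = T • z'` in the `Λ`-adic Selmer datum
(`𝐳_∞ = (γ-1)𝐳_∞'`, Castella (2.3)), then `pr_0(z) = 0` — `T = conj_γ - 1` and `conj_γ` is the
identity on `H¹(K, ·)` (`LambdaAdicSelmerData.proj_zero_X_smul`). Unconditional bookkeeping.
[cite: Howard2004HeegnerKolyvagin, §1 eq. (2)] -/
theorem proj_zero_eq_zero_of_eq_X_smul (D : (W.baseChange K).LambdaAdicSelmerData κ γ) {z z' : D.S}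
    (h : z = (PowerSeries.X : IwasawaAlgebra p) • z') : D.proj 0 z = 0 := by
  rw [h]
  exact LambdaAdicSelmerData.proj_zero_X_smul (W.baseChange K) D z'

/-- **Castella 2024, Thm. 2.1, first assertion, CONDITIONAL on the typed Thm. 1.3** (`E[p]`
irreducible, `p > 3`): at a SPLIT multiplicative `p`, under `Thm13Hypotheses`, the `Λ`-adic Heegner
class `z` of sign `α = a_p = 1` of any Heegner family at level `N = N_E` satisfies `pr_0(z) = 0`
(`D.proj 0 z = 0`): Thm. 1.3 provides `z'` with `z = T • z'` and `pr_0 ∘ T = 0`. In print this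
assertion is proved directly from BD96 (8) (l.428–434); here it is read off the OPEN main-conjecture
binder. [claim: Castella2024, status: under-review] -/
theorem proj_zero_eq_zero_of_thm13_OPEN_of_split [W.IsGloballyMinimal]
    (h : thm13_charIdeal_torsion_eq_sq_OPEN N W K p κ γ jbar) (hyp : Thm13Hypotheses N W K p κ γ)
    (hs : W.HasSplitMultiplicativeReductionAtPrime p) (D : (W.baseChange K).LambdaAdicSelmerData κ γ)
    (F : HeegnerFamily N W K κ jbar) (X : (W.baseChange K).SelmerDualData κ γ) {z : D.S}
    (hz : IsLambdaAdicHeegnerClass D F 1 z) : D.proj 0 z = 0 := by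
  obtain ⟨z', hz', -⟩ := exists_derived_of_thm13_OPEN_of_split h hyp hs D F X hz
  exact proj_zero_eq_zero_of_eq_X_smul D hz'

/-- **The same exceptional zero, read off the PINNED twin `thm13_charIdeal_torsion_eq_sq_minimal_OPEN`**
(TY-QUEUE 25, lead RULING (316), p501225; ARM P DD-70 = r17 ADDENDUM-4 0434952c634f1c51 §D DD-candidate
«`_minimal` twins of the three O9 readers, each taking `F` explicitly: add the same anonymous binders and feed
the twin, so that row 17 has consumers of the CONSISTENT statement»): for a Heegner family whose
parametrisation datum has minimal modular degree (`hmin`, = `ModularParametrizationData.IsMinimal F.Dt`) and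
`p`-adic-unit Manin constant (`hc`, the Manin pin), at a SPLIT multiplicative `p` the class of sign `α = 1`
satisfies `pr_0(z) = 0`. Same proof, one line. [claim: Castella2024, status: under-review] -/
theorem proj_zero_eq_zero_of_thm13_minimal_OPEN_of_split [W.IsGloballyMinimal]
    (h : thm13_charIdeal_torsion_eq_sq_minimal_OPEN N W K p κ γ jbar) (hyp : Thm13Hypotheses N W K p κ γ)
    (hs : W.HasSplitMultiplicativeReductionAtPrime p) (D : (W.baseChange K).LambdaAdicSelmerData κ γ)
    (F : HeegnerFamily N W K κ jbar)
    (hmin : ∀ Dt' : ModularForms.ModularParametrizationData W N, F.Dt.deg ≤ Dt'.deg)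
    (hc : ¬ (p : ℤ) ∣ F.Dt.c) (X : (W.baseChange K).SelmerDualData κ γ) {z : D.S}
    (hz : IsLambdaAdicHeegnerClass D F 1 z) : D.proj 0 z = 0 := by
  obtain ⟨z', hz', -⟩ := (h hyp D F hmin hc X).2.2.2 hs z hz
  exact proj_zero_eq_zero_of_eq_X_smul D hz'

/-- **The same exceptional zero at an EISENSTEIN split multiplicative prime, CONDITIONAL on Keller–Yin
Thm. 5.2.1** (`E[p]` reducible, `p > 2`): under `KellerYin2024.Thm521Hypotheses`, the `Λ`-adic Heegner
class of sign `α = 1` satisfies `pr_0(z) = 0` (KY L1781: "this `(γ-1)` factor reflects a trivial zero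
of the `p`-adic `L`-function"). [claim: KellerYin2024, status: under-review] -/
theorem proj_zero_eq_zero_of_kellerYin_thm521_OPEN_of_split
    (h : KellerYin2024.thm521_multHg_charIdeal_torsion_eq_sq_OPEN N W K p κ γ jbar)
    (hyp : KellerYin2024.Thm521Hypotheses N W K p κ γ)
    (hs : W.HasSplitMultiplicativeReductionAtPrime p) (D : (W.baseChange K).LambdaAdicSelmerData κ γ)
    (F : HeegnerFamily N W K κ jbar) (X : (W.baseChange K).SelmerDualData κ γ) {z : D.S}
    (hz : IsLambdaAdicHeegnerClass D F 1 z) : D.proj 0 z = 0 := by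
  obtain ⟨z', hz', -⟩ := KellerYin2024.exists_derived_of_thm521_OPEN_of_split h hyp hs D F X hz
  exact proj_zero_eq_zero_of_eq_X_smul D hz'

/-! ## Existence forms for COHERENT families (seat bsd-littype-05 g3): the typed binders are
non-vacuous — `Castella2024.exists_isLambdaAdicHeegnerClass` (Bertolini–Darmon 1996 Prop. 2.7,
`LambdaAdicHeegnerClassExistence.lean`) supplies THE `Λ`-adic Heegner class of a norm-compatible
Heegner family (`HeegnerFamily.IsNormCompatible F γ α`, `α = a_p = ±1`), so the `∀ z, IsΛHC … z → …`
clauses of Castella Thm. 1.3 / Keller–Yin Thm. 5.2.1 yield genuine `∃ z` statements. -/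

/-- **Castella 2024 Thm. 1.3 at a NON-SPLIT multiplicative `p`, existence form**: for a Heegner family
at level `N = N_E` that is norm-compatible with sign `a_p = -1`, THE `Λ`-adic Heegner class `𝐳_∞`
exists and `char_Λ(X_tors) = char_Λ(𝔖_p/Λ𝐳_∞)²`. CONDITIONAL on the OPEN fact.
[claim: Castella2024, status: under-review] [cite: BertoliniDarmon1996, §2.5 Prop. 2.7 (p. 435)] -/
theorem exists_heegnerClass_charIdeal_eq_of_thm13_OPEN_of_not_split [W.IsGloballyMinimal]
    (h : thm13_charIdeal_torsion_eq_sq_OPEN N W K p κ γ jbar) (hyp : Thm13Hypotheses N W K p κ γ)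
    (hns : ¬ W.HasSplitMultiplicativeReductionAtPrime p) (D : (W.baseChange K).LambdaAdicSelmerData κ γ)
    {F : HeegnerFamily N W K κ jbar} (hF : F.IsNormCompatible γ (-1))
    (X : (W.baseChange K).SelmerDualData κ γ) :
    ∃ z : D.S, IsLambdaAdicHeegnerClass D F (-1) z ∧
      Module.charIdeal (IwasawaAlgebra p) (Submodule.torsion (IwasawaAlgebra p) X.X) =
        Module.charIdeal (IwasawaAlgebra p) (D.S ⧸ Submodule.span (IwasawaAlgebra p) {z}) ^ 2 := by
  haveI := hyp.isElliptic
  obtain ⟨z, hz⟩ := exists_isLambdaAdicHeegnerClass D F (by norm_num) hF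
  exact ⟨z, hz, charIdeal_torsion_eq_sq_of_thm13_OPEN_of_not_split h hyp hns D F X hz⟩

/-- **Castella 2024 Thm. 1.3 at a NON-SPLIT multiplicative `p`, existence form, read off the PINNED twin
`thm13_charIdeal_torsion_eq_sq_minimal_OPEN`** (TY-QUEUE 25 / DD-70, as above): for a norm-compatible
Heegner family of sign `a_p = -1` whose parametrisation datum is degree-minimal (`hmin`) with `p`-adic-unit
Manin constant (`hc`), THE `Λ`-adic Heegner class `𝐳_∞` exists and `char_Λ(X_tors) = char_Λ(𝔖_p/Λ𝐳_∞)²`.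
CONDITIONAL on the pinned OPEN fact (the CONSISTENT statement; its unpinned parent is refuted integrally
off the pin, `false_of_thm13_OPEN_of_witness`). [claim: Castella2024, status: under-review]
[cite: BertoliniDarmon1996, §2.5 Prop. 2.7 (p. 435)] -/
theorem exists_heegnerClass_charIdeal_eq_of_thm13_minimal_OPEN_of_not_split [W.IsGloballyMinimal]
    (h : thm13_charIdeal_torsion_eq_sq_minimal_OPEN N W K p κ γ jbar) (hyp : Thm13Hypotheses N W K p κ γ)
    (hns : ¬ W.HasSplitMultiplicativeReductionAtPrime p) (D : (W.baseChange K).LambdaAdicSelmerData κ γ)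
    {F : HeegnerFamily N W K κ jbar} (hF : F.IsNormCompatible γ (-1))
    (hmin : ∀ Dt' : ModularForms.ModularParametrizationData W N, F.Dt.deg ≤ Dt'.deg)
    (hc : ¬ (p : ℤ) ∣ F.Dt.c) (X : (W.baseChange K).SelmerDualData κ γ) :
    ∃ z : D.S, IsLambdaAdicHeegnerClass D F (-1) z ∧
      Module.charIdeal (IwasawaAlgebra p) (Submodule.torsion (IwasawaAlgebra p) X.X) =
        Module.charIdeal (IwasawaAlgebra p) (D.S ⧸ Submodule.span (IwasawaAlgebra p) {z}) ^ 2 := by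
  haveI := hyp.isElliptic
  obtain ⟨z, hz⟩ := exists_isLambdaAdicHeegnerClass D F (by norm_num) hF
  exact ⟨z, hz, (h hyp D F hmin hc X).2.2.1 hns z hz⟩

/-- **Castella 2024 Thm. 1.3 at a SPLIT multiplicative `p`, existence form** (with Thm. 2.1's
exceptional zero): for a Heegner family norm-compatible with sign `a_p = 1`, THE class `𝐳_∞` exists,
`pr_0(𝐳_∞) = 0`, and `𝐳_∞ = (γ-1) 𝐳_∞'` with `char_Λ(X_tors) = char_Λ(𝔖_p/Λ𝐳_∞')²`. CONDITIONAL on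
the OPEN fact. [claim: Castella2024, status: under-review] [cite: BertoliniDarmon1996, §2.5 Prop. 2.7 (p. 435)] -/
theorem exists_heegnerClass_derived_of_thm13_OPEN_of_split [W.IsGloballyMinimal]
    (h : thm13_charIdeal_torsion_eq_sq_OPEN N W K p κ γ jbar) (hyp : Thm13Hypotheses N W K p κ γ)
    (hs : W.HasSplitMultiplicativeReductionAtPrime p) (D : (W.baseChange K).LambdaAdicSelmerData κ γ)
    {F : HeegnerFamily N W K κ jbar} (hF : F.IsNormCompatible γ 1)
    (X : (W.baseChange K).SelmerDualData κ γ) :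
    ∃ z z' : D.S, IsLambdaAdicHeegnerClass D F 1 z ∧ D.proj 0 z = 0 ∧
      z = (PowerSeries.X : IwasawaAlgebra p) • z' ∧
      Module.charIdeal (IwasawaAlgebra p) (Submodule.torsion (IwasawaAlgebra p) X.X) =
        Module.charIdeal (IwasawaAlgebra p) (D.S ⧸ Submodule.span (IwasawaAlgebra p) {z'}) ^ 2 := by
  haveI := hyp.isElliptic
  obtain ⟨z, hz⟩ := exists_isLambdaAdicHeegnerClass D F (by norm_num) hF
  obtain ⟨z', hz', hchar⟩ := exists_derived_of_thm13_OPEN_of_split h hyp hs D F X hz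
  exact ⟨z, z', hz, proj_zero_eq_zero_of_eq_X_smul D hz', hz', hchar⟩

/-- **Castella 2024 Thm. 1.3 at a SPLIT multiplicative `p`, existence form (exceptional zero), read off
the PINNED twin `thm13_charIdeal_torsion_eq_sq_minimal_OPEN`** (TY-QUEUE 25 / DD-70, as above): for a
norm-compatible Heegner family of sign `a_p = 1` whose parametrisation datum is degree-minimal (`hmin`) with
`p`-adic-unit Manin constant (`hc`), THE class `𝐳_∞` exists, `pr_0(𝐳_∞) = 0`, and `𝐳_∞ = (γ-1) 𝐳_∞'` with
`char_Λ(X_tors) = char_Λ(𝔖_p/Λ𝐳_∞')²`. CONDITIONAL on the pinned OPEN fact.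
[claim: Castella2024, status: under-review] [cite: BertoliniDarmon1996, §2.5 Prop. 2.7 (p. 435)] -/
theorem exists_heegnerClass_derived_of_thm13_minimal_OPEN_of_split [W.IsGloballyMinimal]
    (h : thm13_charIdeal_torsion_eq_sq_minimal_OPEN N W K p κ γ jbar) (hyp : Thm13Hypotheses N W K p κ γ)
    (hs : W.HasSplitMultiplicativeReductionAtPrime p) (D : (W.baseChange K).LambdaAdicSelmerData κ γ)
    {F : HeegnerFamily N W K κ jbar} (hF : F.IsNormCompatible γ 1)
    (hmin : ∀ Dt' : ModularForms.ModularParametrizationData W N, F.Dt.deg ≤ Dt'.deg)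
    (hc : ¬ (p : ℤ) ∣ F.Dt.c) (X : (W.baseChange K).SelmerDualData κ γ) :
    ∃ z z' : D.S, IsLambdaAdicHeegnerClass D F 1 z ∧ D.proj 0 z = 0 ∧
      z = (PowerSeries.X : IwasawaAlgebra p) • z' ∧
      Module.charIdeal (IwasawaAlgebra p) (Submodule.torsion (IwasawaAlgebra p) X.X) =
        Module.charIdeal (IwasawaAlgebra p) (D.S ⧸ Submodule.span (IwasawaAlgebra p) {z'}) ^ 2 := by
  haveI := hyp.isElliptic
  obtain ⟨z, hz⟩ := exists_isLambdaAdicHeegnerClass D F (by norm_num) hF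
  obtain ⟨z', hz', hchar⟩ := (h hyp D F hmin hc X).2.2.2 hs z hz
  exact ⟨z, z', hz, proj_zero_eq_zero_of_eq_X_smul D hz', hz', hchar⟩

/-- **Keller–Yin Thm. 5.2.1 at a NON-SPLIT multiplicative Eisenstein `p`, existence form**: for a
Heegner family at level `N = N_E` norm-compatible with sign `a_p = -1`, THE `Λ`-adic Heegner class
`𝐳_∞` exists and `char_Λ(𝒳_tors) = char_Λ(𝔖_p/Λ𝐳_∞)²`. CONDITIONAL on the OPEN fact.
[claim: KellerYin2024, status: under-review] [cite: BertoliniDarmon1996, §2.5 Prop. 2.7 (p. 435)] -/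
theorem exists_heegnerClass_charIdeal_eq_of_kellerYin_thm521_OPEN_of_not_split
    (h : KellerYin2024.thm521_multHg_charIdeal_torsion_eq_sq_OPEN N W K p κ γ jbar)
    (hyp : KellerYin2024.Thm521Hypotheses N W K p κ γ)
    (hns : ¬ W.HasSplitMultiplicativeReductionAtPrime p) (D : (W.baseChange K).LambdaAdicSelmerData κ γ)
    {F : HeegnerFamily N W K κ jbar} (hF : F.IsNormCompatible γ (-1))
    (X : (W.baseChange K).SelmerDualData κ γ) :
    ∃ z : D.S, IsLambdaAdicHeegnerClass D F (-1) z ∧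
      Module.charIdeal (IwasawaAlgebra p) (Submodule.torsion (IwasawaAlgebra p) X.X) =
        Module.charIdeal (IwasawaAlgebra p) (D.S ⧸ Submodule.span (IwasawaAlgebra p) {z}) ^ 2 := by
  haveI := hyp.isElliptic
  obtain ⟨z, hz⟩ := exists_isLambdaAdicHeegnerClass D F (by norm_num) hF
  exact ⟨z, hz, KellerYin2024.charIdeal_torsion_eq_sq_of_thm521_OPEN_of_not_split h hyp hns D F X hz⟩

/-- **Keller–Yin Thm. 5.2.1 at a SPLIT multiplicative Eisenstein `p`, existence form**: for a Heegner
family norm-compatible with sign `a_p = 1`, THE class `𝐳_∞` exists, `pr_0(𝐳_∞) = 0` (the trivial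
zero), and `𝐳_∞ = (γ-1) 𝐳_∞'` with `char_Λ(𝒳_tors) = char_Λ(𝔖_p/Λ𝐳_∞')²`. CONDITIONAL on the OPEN
fact. [claim: KellerYin2024, status: under-review] [cite: BertoliniDarmon1996, §2.5 Prop. 2.7 (p. 435)] -/
theorem exists_heegnerClass_derived_of_kellerYin_thm521_OPEN_of_split
    (h : KellerYin2024.thm521_multHg_charIdeal_torsion_eq_sq_OPEN N W K p κ γ jbar)
    (hyp : KellerYin2024.Thm521Hypotheses N W K p κ γ)
    (hs : W.HasSplitMultiplicativeReductionAtPrime p) (D : (W.baseChange K).LambdaAdicSelmerData κ γ)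
    {F : HeegnerFamily N W K κ jbar} (hF : F.IsNormCompatible γ 1)
    (X : (W.baseChange K).SelmerDualData κ γ) :
    ∃ z z' : D.S, IsLambdaAdicHeegnerClass D F 1 z ∧ D.proj 0 z = 0 ∧
      z = (PowerSeries.X : IwasawaAlgebra p) • z' ∧
      Module.charIdeal (IwasawaAlgebra p) (Submodule.torsion (IwasawaAlgebra p) X.X) =
        Module.charIdeal (IwasawaAlgebra p) (D.S ⧸ Submodule.span (IwasawaAlgebra p) {z'}) ^ 2 := by
  haveI := hyp.isElliptic
  obtain ⟨z, hz⟩ := exists_isLambdaAdicHeegnerClass D F (by norm_num) hF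
  obtain ⟨z', hz', hchar⟩ := KellerYin2024.exists_derived_of_thm521_OPEN_of_split h hyp hs D F X hz
  exact ⟨z, z', hz, proj_zero_eq_zero_of_eq_X_smul D hz', hz', hchar⟩

end Literature.NumberTheory.EllipticCurves.Castella2024

end
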